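import Summits.QuantumFields.QCD.Theses.SpectralDefectExtinction
import Summits.QuantumFields.QCD.Theorems.ExtinctionBuildsQCD.Negative.WithoutTightCollapse
import Summits.QuantumFields.QCD.Theorems.ExtinctionBuildsQCD.Negative.TightPinsLine
import Summits.QuantumFields.QCD.Theorems.ExtinctionBuildsQCD.Negative.VolumeLeverBox
import Summits.QuantumFields.QCD.Theorems.ExtinctionBuildsQCD.Negative.IndexBudget
import Summits.QuantumFields.QCD.Theorems.SpectralDefectExtinctionExtinctionBuildsQCDCleanRefStubSchemeVolumeTransfer
import Summits.QuantumFields.QCD.Theorems.PauliWegnerSeaGluonicCompletionSignBudget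
import Literature.MathematicalPhysics.QuantumFieldTheory.QCDPhaseQuenchedReweighting
import Literature.MathematicalPhysics.QuantumLattice.OverlapLocality

/-!
# Stub `stub_signTransfer` of line `weyl-window` — the provable reduction and the open input
(crux `Summit.QuantumFields.QCD.Theses.SpectralDefectExtinction.ExtinctionBuildsQCD`, item stmt-QuantumFields-8968)

WORK FILE (stub-worker, seat c1). The registered `stub_signTransfer` ("honest − phase-quenched → 0 at the
scheme's own side, from the sign cocycle + `SD⁺` + phase-quenched convergence") is NOT provable from its
hypotheses with the tree as it stands: after the sign budget (a) and the Extinct bound on `⟨W⟩₊` (b), what is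
left is the decorrelation `⟨(1 − W) R_k⟩₊ = o(1)` of the determinant sign `W` from the renormalised smeared
probe `R_k` on the RARE sign-defect event — a uniform-integrability / conditional-regularity input that
neither EXTINCT (no rate, first moment of a COUNT) nor the convergence of `⟨R_k⟩₊` (first moment of `R_k`)
controls. This file proves the reduction

* `stub_signTransfer_of_signDefectRegularity` (3a, sorry-free): the registered signature verbatim with ONE
  extra hypothesis per insertion string — SIGN-DEFECT REGULARITY of the honest Berezin numerator along `φ`,
  `‖∫ N_{φk} dμ_W − ∫ W N_{φk} dμ_W‖ ≤ ε ∫ |det D| dμ_W` eventually, every `ε > 0` — via the landed kernel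
  `CleanReferenceDeterminantLocality.tendsto_honest_sub_phaseQuenched` (seat 2, line
  `clean-reference-determinant-locality`, whose S4 met the same wall) and the landed
  `DilutionBuysLocalRarity` toolkit (`det_diracMatrix_eq_norm_of_clean`, `eventually_defectMass_le`);
* `stub_signTransfer_of_reshape`: the kernel-checked composition `3b → 3`, where 3b (`SignDefectRegularity`,
  the open input, stated verbatim as the hypothesis) is the cocycle + `SD⁺` + PQ-convergence ⇒ sign-defect
  regularity along `φ` for every off-diagonal tensor string;
* the same in the COVARIANCE currency: `eventually_signRatio_dichotomy` (EXTINCT at `S = L_{φk}` ⇒ eventually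
  `∫|det D| = ∫det D = 0` or clause (iv) `½ ≤ ‖∫det D‖/∫|det D|`), `signTransfer_of_signDecorrelation` (3a′:
  EXTINCT + `Cov₊(W, R_k) → 0` ⇒ honest − PQ → 0, via the landed sign budget
  `FiniteSignBudgetAtTheSchemeVolume.norm_qcdTorusExpect_sub_phaseQuenched_le`; no boundedness of `⟨R⟩₊` needed)
  and the composition `stub_signTransfer_of_reshape_cov` (3b′ → 3), 3b′ being verbatim the conclusion shape of the
  sibling crux's `GluonicCompletion.stub_signDecorrelation` (item 9152) under this line's hypotheses.

Nothing here is landed (the registered name `stub_signTransfer` is not proved); see `stub_signTransfer_notes.md`.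
-/

noncomputable section

namespace Summit.QuantumFields.QCD.Cruxes.ExtinctionBuildsQCD.WeylWindow

open scoped BigOperators Topology Classical SchwartzMap
open Filter MeasureTheory
open Literature.MathematicalPhysics.QuantumLattice Literature.MathematicalPhysics.QuantumFieldTheory
  Literature.Probability.LatticeModels Literature.MathematicalPhysics.AQFT
open Summit.QuantumFields.QCD.Theorems.ExtinctionBuildsQCD.Negative (Extinct Tight measurable_signDefectCount
  measurable_coercivityDefectCount countP_roots_charpoly_le_card)
open Summit.QuantumFields.QCD.Cruxes.ExtinctionBuildsQCD.DilutionBuysLocalRarity (det_diracMatrix_eq_norm_of_clean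
  eventually_defectMass_le)
open Summit.QuantumFields.QCD.Cruxes.ExtinctionBuildsQCD.CleanReferenceDeterminantLocality
  (tendsto_honest_sub_phaseQuenched norm_integral_det_sub_integral_norm_le)
open Summit.QuantumFields.QCD.Theorems.FiniteSignBudgetAtTheSchemeVolume (norm_qcdTorusExpect_sub_phaseQuenched_le)


/-- **Slim kernel form of 3a** (only the hypotheses that are used: `0 < c`, `0 < m`, EXTINCT, `φ` strictly
increasing, convergence — hence boundedness — of the phase-quenched function of THIS string along `φ`, and sign-defect
regularity along `φ`). -/
theorem signTransfer_of_signDefectRegularity {Nf : ℕ} (reg : QCDRegularisation Nf) {c : ℝ} {m : Fin Nf → ℝ}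
    (z shift : QCDField Nf → ℕ → ℝ) {φ : ℕ → ℕ} {n : ℕ} (σ : Fin n → QCDField Nf)
    (f : Fin n → 𝓢(EuclideanSpace ℝ (Fin 4), ℝ)) {w : ℂ} (hc : 0 < c) (hm0 : ∀ fl, 0 < m fl)
    (hE : Extinct Nf reg c m) (hφ : StrictMono φ)
    (hconv : Tendsto (fun k : ℕ => qcdPhaseQuenchedExpect ((reg.scheme m z shift).β (φ k))
      ((reg.scheme m z shift).side (φ k)) (fun fl => (reg.scheme m z shift).mq fl (φ k))
      (fun U => fermiIntegral ((List.ofFn fun i => smearedInsertion (reg.scheme m z shift) (φ k) U (σ i) (f i)).prod *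
          fermiBoltzmann U fun fl => (reg.scheme m z shift).mq fl (φ k)) /
        fermiIntegral (fermiBoltzmann U fun fl => (reg.scheme m z shift).mq fl (φ k)))) atTop (𝓝 w))
    (hsign : ∀ ε : ℝ, 0 < ε → ∀ᶠ k : ℕ in atTop,
      ‖(∫ U, fermiIntegral ((List.ofFn fun i => smearedInsertion (reg.scheme m z shift) (φ k) U (σ i) (f i)).prod *
            fermiBoltzmann U fun fl => (reg.scheme m z shift).mq fl (φ k)) ∂(qcdGaugeMeasure (reg.scheme m z shift) (φ k))) -
          ∫ U, qcdDetPhase U (fun fl => (reg.scheme m z shift).mq fl (φ k)) *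
            fermiIntegral ((List.ofFn fun i => smearedInsertion (reg.scheme m z shift) (φ k) U (σ i) (f i)).prod *
              fermiBoltzmann U fun fl => (reg.scheme m z shift).mq fl (φ k)) ∂(qcdGaugeMeasure (reg.scheme m z shift) (φ k))‖ ≤
        ε * ∫ U, ‖(diracMatrix U fun fl => (reg.scheme m z shift).mq fl (φ k)).det‖
          ∂(qcdGaugeMeasure (reg.scheme m z shift) (φ k))) :
    Tendsto (fun k : ℕ => qcdLatticeSchwinger (reg.scheme m z shift) (φ k) n σ f -
        qcdPhaseQuenchedExpect ((reg.scheme m z shift).β (φ k)) ((reg.scheme m z shift).side (φ k))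
          (fun fl => (reg.scheme m z shift).mq fl (φ k))
          (fun U => fermiIntegral ((List.ofFn fun i => smearedInsertion (reg.scheme m z shift) (φ k) U (σ i) (f i)).prod *
              fermiBoltzmann U fun fl => (reg.scheme m z shift).mq fl (φ k)) /
            fermiIntegral (fermiBoltzmann U fun fl => (reg.scheme m z shift).mq fl (φ k)))) atTop (𝓝 0) := by
  refine tendsto_honest_sub_phaseQuenched (reg.scheme m z shift) φ
    (fun j U => fermiIntegral ((List.ofFn fun i => smearedInsertion (reg.scheme m z shift) j U (σ i) (f i)).prod *
      fermiBoltzmann U fun fl => (reg.scheme m z shift).mq fl j))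
    (fun j U => (∑ g : Fin Nf, (Multiset.countP (fun z : ℂ => z.im = 0 ∧ z.re < -(reg.mcrit j + reg.a j * m g / reg.Zm j)) (wilsonDirac (fundamentalRep (Fin 3)) U 0 1).charpoly.roots + Multiset.countP (fun z : ℂ => |z.re| < c * (reg.a j * m g / reg.Zm j)) (spinorLift gammaFive * wilsonDirac (fundamentalRep (Fin 3)) U (reg.mcrit j + reg.a j * m g / reg.Zm j) 1).charpoly.roots)))
    ?_ ?_ ?_ ?_ hsign ?_
  · exact fun j => Finset.measurable_sum _ fun g _ =>
      (measurable_signDefectCount _).add (measurable_coercivityDefectCount _ _)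
  · exact fun j => ⟨∑ _g : Fin Nf, (Fintype.card (QuarkIdx ((reg.scheme m z shift).side j)) +
        Fintype.card (QuarkIdx ((reg.scheme m z shift).side j))),
      fun U => Finset.sum_le_sum fun g _ =>
        add_le_add (countP_roots_charpoly_le_card _ _) (countP_roots_charpoly_le_card _ _)⟩
  · exact fun j U hU => det_diracMatrix_eq_norm_of_clean reg hc hm0 j U hU
  · exact fun ε hε => hφ.tendsto_atTop.eventually (eventually_defectMass_le reg c m z shift hE hε)
  · refine ⟨‖w‖ + 1, ?_⟩
    filter_upwards [Metric.tendsto_nhds.1 hconv 1 one_pos] with k hk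
    rw [dist_eq_norm] at hk
    linarith [norm_sub_norm_le (qcdPhaseQuenchedExpect ((reg.scheme m z shift).β (φ k)) ((reg.scheme m z shift).side (φ k)) (fun fl => (reg.scheme m z shift).mq fl (φ k)) (fun U => fermiIntegral ((List.ofFn fun i => smearedInsertion (reg.scheme m z shift) (φ k) U (σ i) (f i)).prod * fermiBoltzmann U fun fl => (reg.scheme m z shift).mq fl (φ k)) / fermiIntegral (fermiBoltzmann U fun fl => (reg.scheme m z shift).mq fl (φ k)))) w]

/-- **EXTINCT at the scheme's own side gives the sign-budget dichotomy**: eventually along `φ`, at step `φ k`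
either the phase-quenched partition function vanishes, `∫ |det D| dμ_W = 0` (then `∫ det D dμ_W = 0` too), or
clause (iv) holds there, `½ ≤ ‖∫ det D dμ_W‖ / ∫ |det D| dμ_W` (`‖∫det D − ∫|det D|‖ ≤ 2∫N|det D| ≤ ½∫|det D|`). -/
theorem eventually_signRatio_dichotomy {Nf : ℕ} (reg : QCDRegularisation Nf) {c : ℝ} {m : Fin Nf → ℝ}
    (z shift : QCDField Nf → ℕ → ℝ) {φ : ℕ → ℕ} (hc : 0 < c) (hm0 : ∀ fl, 0 < m fl) (hE : Extinct Nf reg c m)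
    (hφ : StrictMono φ) :
    ∀ᶠ k : ℕ in atTop,
      ((∫ U, ‖(diracMatrix U fun fl => (reg.scheme m z shift).mq fl (φ k)).det‖
            ∂(qcdGaugeMeasure (reg.scheme m z shift) (φ k))) = 0 ∧
          (∫ U, (diracMatrix U fun fl => (reg.scheme m z shift).mq fl (φ k)).det
            ∂(qcdGaugeMeasure (reg.scheme m z shift) (φ k))) = 0) ∨
        (1 / 2 : ℝ) ≤ ‖∫ U, (diracMatrix U fun fl => (reg.scheme m z shift).mq fl (φ k)).det
            ∂(qcdGaugeMeasure (reg.scheme m z shift) (φ k))‖ /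
          ∫ U, ‖(diracMatrix U fun fl => (reg.scheme m z shift).mq fl (φ k)).det‖
            ∂(qcdGaugeMeasure (reg.scheme m z shift) (φ k)) := by
  have hrare := hφ.tendsto_atTop.eventually
    (eventually_defectMass_le reg c m z shift hE (by norm_num : (0 : ℝ) < 1 / 4))
  filter_upwards [hrare] with k hRk
  set sch := reg.scheme m z shift with hsch
  haveI : IsProbabilityMeasure (qcdGaugeMeasure sch (φ k)) := isProbabilityMeasure_wilsonMeasure_fundamental _
  have hNm : Measurable fun U : GaugeConfig 4 (sch.side (φ k)) SU3 =>
      ∑ g : Fin Nf, (Multiset.countP (fun z : ℂ => z.im = 0 ∧ z.re < -(reg.mcrit (φ k) + reg.a (φ k) * m g / reg.Zm (φ k))) (wilsonDirac (fundamentalRep (Fin 3)) U 0 1).charpoly.roots + Multiset.countP (fun z : ℂ => |z.re| < c * (reg.a (φ k) * m g / reg.Zm (φ k))) (spinorLift gammaFive * wilsonDirac (fundamentalRep (Fin 3)) U (reg.mcrit (φ k) + reg.a (φ k) * m g / reg.Zm (φ k)) 1).charpoly.roots) :=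
    Finset.measurable_sum _ fun g _ => (measurable_signDefectCount _).add (measurable_coercivityDefectCount _ _)
  have hNb : ∀ U : GaugeConfig 4 (sch.side (φ k)) SU3,
      (∑ g : Fin Nf, (Multiset.countP (fun z : ℂ => z.im = 0 ∧ z.re < -(reg.mcrit (φ k) + reg.a (φ k) * m g / reg.Zm (φ k))) (wilsonDirac (fundamentalRep (Fin 3)) U 0 1).charpoly.roots + Multiset.countP (fun z : ℂ => |z.re| < c * (reg.a (φ k) * m g / reg.Zm (φ k))) (spinorLift gammaFive * wilsonDirac (fundamentalRep (Fin 3)) U (reg.mcrit (φ k) + reg.a (φ k) * m g / reg.Zm (φ k)) 1).charpoly.roots)) ≤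
        ∑ _g : Fin Nf, (Fintype.card (QuarkIdx (sch.side (φ k))) + Fintype.card (QuarkIdx (sch.side (φ k)))) :=
    fun U => Finset.sum_le_sum fun g _ =>
      add_le_add (countP_roots_charpoly_le_card _ _) (countP_roots_charpoly_le_card _ _)
  have hBZ := norm_integral_det_sub_integral_norm_le (qcdGaugeMeasure sch (φ k)) (fun fl => sch.mq fl (φ k)) hNm hNb
    (fun U hU => det_diracMatrix_eq_norm_of_clean reg hc hm0 (φ k) U hU)
  set Z : ℝ := ∫ U, ‖(diracMatrix U fun fl => sch.mq fl (φ k)).det‖ ∂(qcdGaugeMeasure sch (φ k)) with hZ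
  set B : ℂ := ∫ U, (diracMatrix U fun fl => sch.mq fl (φ k)).det ∂(qcdGaugeMeasure sch (φ k)) with hB
  have hZ0 : 0 ≤ Z := integral_nonneg fun U => norm_nonneg _
  have hBZ' : ‖B - (Z : ℂ)‖ ≤ Z / 2 := hBZ.trans (by linarith)
  rcases hZ0.eq_or_lt with hZz | hZpos
  · left
    refine ⟨hZz.symm, ?_⟩
    have : ‖B - (Z : ℂ)‖ ≤ 0 := by rw [← hZz] at hBZ' ⊢; simpa using hBZ'
    have hB0 : B = (Z : ℂ) := sub_eq_zero.1 (norm_le_zero_iff.1 this)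
    rw [hB0, ← hZz, Complex.ofReal_zero]
  · right
    rw [le_div_iff₀ hZpos]
    have h1 : ‖(Z : ℂ)‖ - ‖B‖ ≤ ‖B - (Z : ℂ)‖ := by rw [norm_sub_rev]; exact norm_sub_norm_le _ _
    rw [Complex.norm_real, Real.norm_eq_abs, abs_of_pos hZpos] at h1
    linarith

/-- **Slim kernel form of 3a′ (COVARIANCE currency)**: along `φ`, EXTINCT + `⟨W R⟩₊ − ⟨W⟩₊⟨R⟩₊ → 0` for the
Berezin ratio `R` of THIS string give `honest − ⟨R⟩₊ → 0` — no boundedness of `⟨R⟩₊` needed. Eventually either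
the partition functions vanish (both functionals are the junk `0`) or clause (iv) holds and the landed sign budget
`norm_qcdTorusExpect_sub_phaseQuenched_le` bounds `‖honest − ⟨R⟩₊‖ ≤ 2‖Cov₊(W, R)‖`. This matches VERBATIM the
conclusion shape of the sibling crux's `GluonicCompletion.stub_signDecorrelation` (item 9152). -/
theorem signTransfer_of_signDecorrelation {Nf : ℕ} (reg : QCDRegularisation Nf) {c : ℝ} {m : Fin Nf → ℝ}
    (z shift : QCDField Nf → ℕ → ℝ) {φ : ℕ → ℕ} {n : ℕ} (σ : Fin n → QCDField Nf)
    (f : Fin n → 𝓢(EuclideanSpace ℝ (Fin 4), ℝ)) (hc : 0 < c) (hm0 : ∀ fl, 0 < m fl)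
    (hE : Extinct Nf reg c m) (hφ : StrictMono φ)
    (hcov : Tendsto (fun k : ℕ =>
      (qcdPhaseQuenchedExpect ((reg.scheme m z shift).β (φ k)) ((reg.scheme m z shift).side (φ k)) (fun fl => (reg.scheme m z shift).mq fl (φ k)) (fun U => qcdDetPhase U (fun fl => (reg.scheme m z shift).mq fl (φ k)) * (fermiIntegral ((List.ofFn fun i => smearedInsertion (reg.scheme m z shift) (φ k) U (σ i) (f i)).prod * fermiBoltzmann U fun fl => (reg.scheme m z shift).mq fl (φ k)) / fermiIntegral (fermiBoltzmann U fun fl => (reg.scheme m z shift).mq fl (φ k)))) -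
        qcdPhaseQuenchedExpect ((reg.scheme m z shift).β (φ k)) ((reg.scheme m z shift).side (φ k)) (fun fl => (reg.scheme m z shift).mq fl (φ k)) (fun U => qcdDetPhase U (fun fl => (reg.scheme m z shift).mq fl (φ k))) *
          qcdPhaseQuenchedExpect ((reg.scheme m z shift).β (φ k)) ((reg.scheme m z shift).side (φ k)) (fun fl => (reg.scheme m z shift).mq fl (φ k)) (fun U => (fermiIntegral ((List.ofFn fun i => smearedInsertion (reg.scheme m z shift) (φ k) U (σ i) (f i)).prod * fermiBoltzmann U fun fl => (reg.scheme m z shift).mq fl (φ k)) / fermiIntegral (fermiBoltzmann U fun fl => (reg.scheme m z shift).mq fl (φ k)))))) atTop (𝓝 0)) :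
    Tendsto (fun k : ℕ => qcdLatticeSchwinger (reg.scheme m z shift) (φ k) n σ f -
        qcdPhaseQuenchedExpect ((reg.scheme m z shift).β (φ k)) ((reg.scheme m z shift).side (φ k))
          (fun fl => (reg.scheme m z shift).mq fl (φ k))
          (fun U => fermiIntegral ((List.ofFn fun i => smearedInsertion (reg.scheme m z shift) (φ k) U (σ i) (f i)).prod *
              fermiBoltzmann U fun fl => (reg.scheme m z shift).mq fl (φ k)) /
            fermiIntegral (fermiBoltzmann U fun fl => (reg.scheme m z shift).mq fl (φ k)))) atTop (𝓝 0) := by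
  set sch := reg.scheme m z shift with hsch
  rw [Metric.tendsto_nhds] at hcov ⊢
  intro η hη
  filter_upwards [eventually_signRatio_dichotomy reg z shift hc hm0 hE hφ, hcov (η / 2) (half_pos hη)] with k hk hCk
  rw [dist_zero_right] at hCk ⊢
  rcases hk with ⟨hZ, hB⟩ | hIV
  · -- junk case: both functionals vanish
    have hG : (∫ U, fermiIntegral (fermiBoltzmann U fun fl => sch.mq fl (φ k)) ∂(qcdGaugeMeasure sch (φ k))) = 0 := by
      have : (fun U : GaugeConfig 4 (sch.side (φ k)) SU3 => fermiIntegral (fermiBoltzmann U fun fl => sch.mq fl (φ k))) =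
          fun U => (-1 : ℂ) ^ (Fintype.card (FermiIdx Nf (sch.side (φ k))) *
            (Fintype.card (FermiIdx Nf (sch.side (φ k))) - 1) / 2 + Fintype.card (FermiIdx Nf (sch.side (φ k)))) *
            (diracMatrix U fun fl => sch.mq fl (φ k)).det :=
        funext fun U => fermiIntegral_fermiBoltzmann U _
      rw [this, integral_const_mul, hB, mul_zero]
    have h1 : qcdLatticeSchwinger sch (φ k) n σ f = 0 := by
      rw [qcdLatticeSchwinger, hG, div_zero]
    have h2 : qcdPhaseQuenchedExpect (sch.β (φ k)) (sch.side (φ k)) (fun fl => sch.mq fl (φ k))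
        (fun U => fermiIntegral ((List.ofFn fun i => smearedInsertion sch (φ k) U (σ i) (f i)).prod *
            fermiBoltzmann U fun fl => sch.mq fl (φ k)) /
          fermiIntegral (fermiBoltzmann U fun fl => sch.mq fl (φ k))) = 0 := by
      rw [qcdPhaseQuenchedExpect_def]
      change (∫ U, ‖(diracMatrix U fun fl => sch.mq fl (φ k)).det‖ ∂(qcdGaugeMeasure sch (φ k)))⁻¹ • _ = (0 : ℂ)
      rw [hZ, inv_zero, zero_smul]
    rw [h1, h2, sub_zero, norm_zero]
    exact hη
  · have hbud := norm_qcdTorusExpect_sub_phaseQuenched_le (sch.β (φ k)) (fun fl => sch.mq fl (φ k))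
      (fun U => (List.ofFn fun i => smearedInsertion sch (φ k) U (σ i) (f i)).prod) hIV
    change ‖qcdTorusExpect (sch.β (φ k)) (sch.side (φ k)) (fun fl => sch.mq fl (φ k))
      (fun U => (List.ofFn fun i => smearedInsertion sch (φ k) U (σ i) (f i)).prod) - _‖ < η
    refine hbud.trans_lt ?_
    linarith

/-- **3a — SIGN TRANSFER FROM SIGN-DEFECT REGULARITY (the provable reduction of `stub_signTransfer`).** The
registered signature of `stub_signTransfer` verbatim, plus — for the given off-diagonal insertion string
`(n, σ, f)` — the hypothesis that along `φ` the sign-defective part of the honest Berezin numerator,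
`∫ (1 − W) N dμ_W = 2∫_{det D<0} N dμ_W + ∫_{det D=0} N dμ_W`, is `o(∫ |det D| dμ_W)`. Of the registered hypotheses
only `0 ≤ M₀ < m`, `0 < c`, EXTINCT (at `S = L_{φ k}`, `eventually_defectMass_le`: defect mass `o(∫|det D|)`, hence
`‖∫det D − ∫|det D|‖ ≤ 2ε∫|det D|`, i.e. `⟨W⟩₊ ≥ 1 − 2ε`) and the phase-quenched convergence for THIS string
(boundedness of `⟨R⟩₊`) are used; the cocycle, TIGHT, both scaling laws, the volume cap and the branch clause
are inert. Kernel: `tendsto_honest_sub_phaseQuenched` (per torus `‖honest − PQ‖ ≤ 2δ + 4ε‖PQ‖`, junk case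
`∫|det D| = 0` included). -/
theorem stub_signTransfer_of_signDefectRegularity :
    (∃ C : ℝ, 0 < C ∧ ∀ (L : ℕ) [NeZero L] (t m₀ : ℝ), 0 < t → t ≤ 1 → |m₀| ≤ 1 →
      ∀ (x₀ : TorusSite 4 L) (R ℓ : ℕ), C * (1 + Real.log (L : ℝ)) / t ≤ (ℓ : ℝ) →
      ∀ (U₁ V₁ U₂ V₂ : GaugeConfig 4 L SU3),
        (∀ e : TorusSite 4 L × Fin 4, R < torusTaxiDist e.1 x₀ → V₁ e = U₁ e ∧ V₂ e = U₂ e) →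
        (∀ e : TorusSite 4 L × Fin 4, torusTaxiDist e.1 x₀ ≤ R + ℓ → U₂ e = U₁ e ∧ V₂ e = V₁ e) →
        (∀ U ∈ [U₁, V₁, U₂, V₂], Multiset.countP (fun z : ℂ => |z.re| < t)
          (spinorLift gammaFive * wilsonDirac (fundamentalRep (Fin 3)) U m₀ 1).charpoly.roots = 0) →
        (Multiset.countP (fun z : ℂ => z.re < 0)
            (spinorLift gammaFive * wilsonDirac (fundamentalRep (Fin 3)) V₁ m₀ 1).charpoly.roots : ℤ) -
          Multiset.countP (fun z : ℂ => z.re < 0)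
            (spinorLift gammaFive * wilsonDirac (fundamentalRep (Fin 3)) U₁ m₀ 1).charpoly.roots =
        (Multiset.countP (fun z : ℂ => z.re < 0)
            (spinorLift gammaFive * wilsonDirac (fundamentalRep (Fin 3)) V₂ m₀ 1).charpoly.roots : ℤ) -
          Multiset.countP (fun z : ℂ => z.re < 0)
            (spinorLift gammaFive * wilsonDirac (fundamentalRep (Fin 3)) U₂ m₀ 1).charpoly.roots) →
    ∀ (Nf : ℕ), Nf = 2 ∨ Nf = 3 → ∀ (reg : QCDRegularisation Nf) (M₀ c : ℝ), 0 ≤ M₀ → 0 < c →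
      reg.HasMassScaling → (reg.scheme 0 0 0).HasAsymptoticScaling →
      (∀ m : Fin Nf → ℝ, (∀ f, M₀ < m f) →
        Summit.QuantumFields.QCD.Theorems.ExtinctionBuildsQCD.Negative.Extinct Nf reg c m ∧
          Summit.QuantumFields.QCD.Theorems.ExtinctionBuildsQCD.Negative.Tight Nf reg M₀ m) →
      (∃ p : ℕ, ∀ᶠ k in atTop, (reg.L k : ℝ) ≤ (reg.a k)⁻¹ ^ p) → (∀ᶠ k in atTop, -1 < reg.mcrit k) →
      ∀ m : Fin Nf → ℝ, (∀ f, M₀ < m f) → ∀ (z shift : QCDField Nf → ℕ → ℝ) (φ : ℕ → ℕ), StrictMono φ →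
        (∃ T : OSData (QCDField Nf) 4, ∀ (n : ℕ), n ≠ 0 → ∀ (σ : Fin n → QCDField Nf)
            (f : Fin n → 𝓢(EuclideanSpace ℝ (Fin 4), ℝ)) (F : 𝓢((Fin n → EuclideanSpace ℝ (Fin 4)), ℂ)),
            IsTensorOf F (fun i => ofRealTest (f i)) → IsOffDiagonal F →
            Tendsto (fun k : ℕ => qcdPhaseQuenchedExpect ((reg.scheme m z shift).β (φ k))
              ((reg.scheme m z shift).side (φ k)) (fun fl => (reg.scheme m z shift).mq fl (φ k))
              (fun U => fermiIntegral ((List.ofFn fun i => smearedInsertion (reg.scheme m z shift) (φ k) U (σ i) (f i)).prod *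
                  fermiBoltzmann U fun fl => (reg.scheme m z shift).mq fl (φ k)) /
                fermiIntegral (fermiBoltzmann U fun fl => (reg.scheme m z shift).mq fl (φ k)))) atTop
              (𝓝 (T.schwinger n σ F))) →
        ∀ (n : ℕ), n ≠ 0 → ∀ (σ : Fin n → QCDField Nf) (f : Fin n → 𝓢(EuclideanSpace ℝ (Fin 4), ℝ))
          (F : 𝓢((Fin n → EuclideanSpace ℝ (Fin 4)), ℂ)), IsTensorOf F (fun i => ofRealTest (f i)) → IsOffDiagonal F →
          (∀ ε : ℝ, 0 < ε → ∀ᶠ k : ℕ in atTop,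
            ‖(∫ U, fermiIntegral ((List.ofFn fun i => smearedInsertion (reg.scheme m z shift) (φ k) U (σ i) (f i)).prod *
                  fermiBoltzmann U fun fl => (reg.scheme m z shift).mq fl (φ k)) ∂(qcdGaugeMeasure (reg.scheme m z shift) (φ k))) -
                ∫ U, qcdDetPhase U (fun fl => (reg.scheme m z shift).mq fl (φ k)) *
                  fermiIntegral ((List.ofFn fun i => smearedInsertion (reg.scheme m z shift) (φ k) U (σ i) (f i)).prod *
                    fermiBoltzmann U fun fl => (reg.scheme m z shift).mq fl (φ k)) ∂(qcdGaugeMeasure (reg.scheme m z shift) (φ k))‖ ≤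
              ε * ∫ U, ‖(diracMatrix U fun fl => (reg.scheme m z shift).mq fl (φ k)).det‖
                ∂(qcdGaugeMeasure (reg.scheme m z shift) (φ k))) →
          Tendsto (fun k : ℕ => qcdLatticeSchwinger (reg.scheme m z shift) (φ k) n σ f -
              qcdPhaseQuenchedExpect ((reg.scheme m z shift).β (φ k)) ((reg.scheme m z shift).side (φ k))
                (fun fl => (reg.scheme m z shift).mq fl (φ k))
                (fun U => fermiIntegral ((List.ofFn fun i => smearedInsertion (reg.scheme m z shift) (φ k) U (σ i) (f i)).prod *
                    fermiBoltzmann U fun fl => (reg.scheme m z shift).mq fl (φ k)) /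
                  fermiIntegral (fermiBoltzmann U fun fl => (reg.scheme m z shift).mq fl (φ k)))) atTop (𝓝 0) := by
  intro _ Nf _ reg M₀ c hM₀ hc _ _ hbody _ _ m hm z shift φ hφ hPQ n hn σ f F hF hoff hsign
  obtain ⟨T, hT⟩ := hPQ
  exact signTransfer_of_signDefectRegularity reg z shift σ f hc (fun fl => hM₀.trans_lt (hm fl)) (hbody m hm).1 hφ
    (hT n hn σ f F hF hoff) hsign

/-- **Composition check `3b → 3` (kernel-checked reshape).** If the open input 3b — SIGN-DEFECT REGULARITY along
`φ` (the hypothesis `h3b`, stated verbatim as the lead would register it: cocycle `→ SD⁺ →` PQ-convergence `→` for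
every off-diagonal tensor string, `‖∫ N_{φk} − ∫ W N_{φk}‖ = o(∫|det D|)`) — holds, then the registered statement of
`stub_signTransfer` follows verbatim from 3a. -/
theorem stub_signTransfer_of_reshape
    (h3b :
      (∃ C : ℝ, 0 < C ∧ ∀ (L : ℕ) [NeZero L] (t m₀ : ℝ), 0 < t → t ≤ 1 → |m₀| ≤ 1 →
        ∀ (x₀ : TorusSite 4 L) (R ℓ : ℕ), C * (1 + Real.log (L : ℝ)) / t ≤ (ℓ : ℝ) →
        ∀ (U₁ V₁ U₂ V₂ : GaugeConfig 4 L SU3),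
          (∀ e : TorusSite 4 L × Fin 4, R < torusTaxiDist e.1 x₀ → V₁ e = U₁ e ∧ V₂ e = U₂ e) →
          (∀ e : TorusSite 4 L × Fin 4, torusTaxiDist e.1 x₀ ≤ R + ℓ → U₂ e = U₁ e ∧ V₂ e = V₁ e) →
          (∀ U ∈ [U₁, V₁, U₂, V₂], Multiset.countP (fun z : ℂ => |z.re| < t)
            (spinorLift gammaFive * wilsonDirac (fundamentalRep (Fin 3)) U m₀ 1).charpoly.roots = 0) →
          (Multiset.countP (fun z : ℂ => z.re < 0)
              (spinorLift gammaFive * wilsonDirac (fundamentalRep (Fin 3)) V₁ m₀ 1).charpoly.roots : ℤ) -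
            Multiset.countP (fun z : ℂ => z.re < 0)
              (spinorLift gammaFive * wilsonDirac (fundamentalRep (Fin 3)) U₁ m₀ 1).charpoly.roots =
          (Multiset.countP (fun z : ℂ => z.re < 0)
              (spinorLift gammaFive * wilsonDirac (fundamentalRep (Fin 3)) V₂ m₀ 1).charpoly.roots : ℤ) -
            Multiset.countP (fun z : ℂ => z.re < 0)
              (spinorLift gammaFive * wilsonDirac (fundamentalRep (Fin 3)) U₂ m₀ 1).charpoly.roots) →
      ∀ (Nf : ℕ), Nf = 2 ∨ Nf = 3 → ∀ (reg : QCDRegularisation Nf) (M₀ c : ℝ), 0 ≤ M₀ → 0 < c →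
        reg.HasMassScaling → (reg.scheme 0 0 0).HasAsymptoticScaling →
        (∀ m : Fin Nf → ℝ, (∀ f, M₀ < m f) →
          Summit.QuantumFields.QCD.Theorems.ExtinctionBuildsQCD.Negative.Extinct Nf reg c m ∧
            Summit.QuantumFields.QCD.Theorems.ExtinctionBuildsQCD.Negative.Tight Nf reg M₀ m) →
        (∃ p : ℕ, ∀ᶠ k in atTop, (reg.L k : ℝ) ≤ (reg.a k)⁻¹ ^ p) → (∀ᶠ k in atTop, -1 < reg.mcrit k) →
        ∀ m : Fin Nf → ℝ, (∀ f, M₀ < m f) → ∀ (z shift : QCDField Nf → ℕ → ℝ) (φ : ℕ → ℕ), StrictMono φ →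
          (∃ T : OSData (QCDField Nf) 4, ∀ (n : ℕ), n ≠ 0 → ∀ (σ : Fin n → QCDField Nf)
              (f : Fin n → 𝓢(EuclideanSpace ℝ (Fin 4), ℝ)) (F : 𝓢((Fin n → EuclideanSpace ℝ (Fin 4)), ℂ)),
              IsTensorOf F (fun i => ofRealTest (f i)) → IsOffDiagonal F →
              Tendsto (fun k : ℕ => qcdPhaseQuenchedExpect ((reg.scheme m z shift).β (φ k))
                ((reg.scheme m z shift).side (φ k)) (fun fl => (reg.scheme m z shift).mq fl (φ k))
                (fun U => fermiIntegral ((List.ofFn fun i => smearedInsertion (reg.scheme m z shift) (φ k) U (σ i) (f i)).prod *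
                    fermiBoltzmann U fun fl => (reg.scheme m z shift).mq fl (φ k)) /
                  fermiIntegral (fermiBoltzmann U fun fl => (reg.scheme m z shift).mq fl (φ k)))) atTop
                (𝓝 (T.schwinger n σ F))) →
          ∀ (n : ℕ), n ≠ 0 → ∀ (σ : Fin n → QCDField Nf) (f : Fin n → 𝓢(EuclideanSpace ℝ (Fin 4), ℝ))
            (F : 𝓢((Fin n → EuclideanSpace ℝ (Fin 4)), ℂ)), IsTensorOf F (fun i => ofRealTest (f i)) → IsOffDiagonal F →
            (∀ ε : ℝ, 0 < ε → ∀ᶠ k : ℕ in atTop,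
              ‖(∫ U, fermiIntegral ((List.ofFn fun i => smearedInsertion (reg.scheme m z shift) (φ k) U (σ i) (f i)).prod *
                    fermiBoltzmann U fun fl => (reg.scheme m z shift).mq fl (φ k)) ∂(qcdGaugeMeasure (reg.scheme m z shift) (φ k))) -
                  ∫ U, qcdDetPhase U (fun fl => (reg.scheme m z shift).mq fl (φ k)) *
                    fermiIntegral ((List.ofFn fun i => smearedInsertion (reg.scheme m z shift) (φ k) U (σ i) (f i)).prod *
                      fermiBoltzmann U fun fl => (reg.scheme m z shift).mq fl (φ k)) ∂(qcdGaugeMeasure (reg.scheme m z shift) (φ k))‖ ≤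
                ε * ∫ U, ‖(diracMatrix U fun fl => (reg.scheme m z shift).mq fl (φ k)).det‖
                  ∂(qcdGaugeMeasure (reg.scheme m z shift) (φ k)))) :
    (∃ C : ℝ, 0 < C ∧ ∀ (L : ℕ) [NeZero L] (t m₀ : ℝ), 0 < t → t ≤ 1 → |m₀| ≤ 1 →
      ∀ (x₀ : TorusSite 4 L) (R ℓ : ℕ), C * (1 + Real.log (L : ℝ)) / t ≤ (ℓ : ℝ) →
      ∀ (U₁ V₁ U₂ V₂ : GaugeConfig 4 L SU3),
        (∀ e : TorusSite 4 L × Fin 4, R < torusTaxiDist e.1 x₀ → V₁ e = U₁ e ∧ V₂ e = U₂ e) →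
        (∀ e : TorusSite 4 L × Fin 4, torusTaxiDist e.1 x₀ ≤ R + ℓ → U₂ e = U₁ e ∧ V₂ e = V₁ e) →
        (∀ U ∈ [U₁, V₁, U₂, V₂], Multiset.countP (fun z : ℂ => |z.re| < t)
          (spinorLift gammaFive * wilsonDirac (fundamentalRep (Fin 3)) U m₀ 1).charpoly.roots = 0) →
        (Multiset.countP (fun z : ℂ => z.re < 0)
            (spinorLift gammaFive * wilsonDirac (fundamentalRep (Fin 3)) V₁ m₀ 1).charpoly.roots : ℤ) -
          Multiset.countP (fun z : ℂ => z.re < 0)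
            (spinorLift gammaFive * wilsonDirac (fundamentalRep (Fin 3)) U₁ m₀ 1).charpoly.roots =
        (Multiset.countP (fun z : ℂ => z.re < 0)
            (spinorLift gammaFive * wilsonDirac (fundamentalRep (Fin 3)) V₂ m₀ 1).charpoly.roots : ℤ) -
          Multiset.countP (fun z : ℂ => z.re < 0)
            (spinorLift gammaFive * wilsonDirac (fundamentalRep (Fin 3)) U₂ m₀ 1).charpoly.roots) →
    ∀ (Nf : ℕ), Nf = 2 ∨ Nf = 3 → ∀ (reg : QCDRegularisation Nf) (M₀ c : ℝ), 0 ≤ M₀ → 0 < c →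
      reg.HasMassScaling → (reg.scheme 0 0 0).HasAsymptoticScaling →
      (∀ m : Fin Nf → ℝ, (∀ f, M₀ < m f) →
        Summit.QuantumFields.QCD.Theorems.ExtinctionBuildsQCD.Negative.Extinct Nf reg c m ∧
          Summit.QuantumFields.QCD.Theorems.ExtinctionBuildsQCD.Negative.Tight Nf reg M₀ m) →
      (∃ p : ℕ, ∀ᶠ k in atTop, (reg.L k : ℝ) ≤ (reg.a k)⁻¹ ^ p) → (∀ᶠ k in atTop, -1 < reg.mcrit k) →
      ∀ m : Fin Nf → ℝ, (∀ f, M₀ < m f) → ∀ (z shift : QCDField Nf → ℕ → ℝ) (φ : ℕ → ℕ), StrictMono φ →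
        (∃ T : OSData (QCDField Nf) 4, ∀ (n : ℕ), n ≠ 0 → ∀ (σ : Fin n → QCDField Nf)
            (f : Fin n → 𝓢(EuclideanSpace ℝ (Fin 4), ℝ)) (F : 𝓢((Fin n → EuclideanSpace ℝ (Fin 4)), ℂ)),
            IsTensorOf F (fun i => ofRealTest (f i)) → IsOffDiagonal F →
            Tendsto (fun k : ℕ => qcdPhaseQuenchedExpect ((reg.scheme m z shift).β (φ k))
              ((reg.scheme m z shift).side (φ k)) (fun fl => (reg.scheme m z shift).mq fl (φ k))
              (fun U => fermiIntegral ((List.ofFn fun i => smearedInsertion (reg.scheme m z shift) (φ k) U (σ i) (f i)).prod *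
                  fermiBoltzmann U fun fl => (reg.scheme m z shift).mq fl (φ k)) /
                fermiIntegral (fermiBoltzmann U fun fl => (reg.scheme m z shift).mq fl (φ k)))) atTop
              (𝓝 (T.schwinger n σ F))) →
        ∀ (n : ℕ), n ≠ 0 → ∀ (σ : Fin n → QCDField Nf) (f : Fin n → 𝓢(EuclideanSpace ℝ (Fin 4), ℝ))
          (F : 𝓢((Fin n → EuclideanSpace ℝ (Fin 4)), ℂ)), IsTensorOf F (fun i => ofRealTest (f i)) → IsOffDiagonal F →
          Tendsto (fun k : ℕ => qcdLatticeSchwinger (reg.scheme m z shift) (φ k) n σ f -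
              qcdPhaseQuenchedExpect ((reg.scheme m z shift).β (φ k)) ((reg.scheme m z shift).side (φ k))
                (fun fl => (reg.scheme m z shift).mq fl (φ k))
                (fun U => fermiIntegral ((List.ofFn fun i => smearedInsertion (reg.scheme m z shift) (φ k) U (σ i) (f i)).prod *
                    fermiBoltzmann U fun fl => (reg.scheme m z shift).mq fl (φ k)) /
                  fermiIntegral (fermiBoltzmann U fun fl => (reg.scheme m z shift).mq fl (φ k)))) atTop (𝓝 0) :=
  fun h Nf hNf reg M₀ c hM₀ hc hMS hAS hbody hcap hbr m hm z shift φ hφ hPQ n hn σ f F hF hoff =>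
    stub_signTransfer_of_signDefectRegularity h Nf hNf reg M₀ c hM₀ hc hMS hAS hbody hcap hbr m hm z shift φ hφ
      hPQ n hn σ f F hF hoff
      (h3b h Nf hNf reg M₀ c hM₀ hc hMS hAS hbody hcap hbr m hm z shift φ hφ hPQ n hn σ f F hF hoff)

end Summit.QuantumFields.QCD.Cruxes.ExtinctionBuildsQCD.WeylWindow

end
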